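import Summits.PneNP.PneNP.Theses.OneSlice
import Literature.Computability.Complexity.CircuitRestriction
import Literature.Computability.Complexity.Rossman2008CliqueProofs
import Literature.Computability.Complexity.RossmanMonotoneCliqueProofs
import Literature.Computability.Complexity.ACRealizeConnectives
import Literature.Computability.Complexity.CircuitInputMap
import Literature.Computability.Complexity.FourierTails

/-!
# Skeleton line `russo-window-ladder` for crux `SliceACZero` (stmt-PneNP-2835)

Route `PneNP/OneSlice`; crux decl `Summit.PneNP.PneNP.Theses.OneSlice.SliceACZero` = `Hyp → Conc`
(`Hyp`: fixed-δ, window-uniform single-threshold average-case AC⁰ lower bound for k-CLIQUE on `G(n,q)`;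
`Conc`: the same on every central Hamming slice `G(n,j)`; read back here DEFINITIONALLY as
`CruxHyp → CruxConc`, `sliceACZero_iff : SliceACZero ↔ (CruxHyp → CruxConc) := Iff.rfl`, in the vocabulary
`mk`/`sliceErr`/`sliceCard`/`gnpDisagreeProb`/`cliqueFn` of `Cruxes/SliceACZero/Disproof.lean`); idea card
`Cruxes/SliceACZero/Ideas/russo-window-ladder.md` (ideator 2; triage r1: pass ×3 — the sharpenings "single density
with hybrid weights instead of the dyadic ladder" and "AND-coin instead of the comparator blow-up" are adopted).

THE LINE (Russo–Margulis read slice by slice). For a Boolean `f` on a finite cube `{0,1}^ι`, `N = |ι|`: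
`a_ℓ(f)` = fraction of slice `ℓ` where `f = 1` (`sliceAvg`, count/count), `E_q f` = `μ_q`-mass of `{f = 1}`
(`prodAvg`), `upPivotal f` = the bichromatic UP-edges `(x,i)` (`x_i = 0`, `f x ≠ f (x + e_i)`),
`I_q(f) = Σ_{(x,i) ∈ upPivotal f} q^{|x|}(1-q)^{N-1-|x|}` = the UNSIGNED `μ_q`-total influence
(`biasedInfluence`; at `q = 1/2` it is the ordinary total influence `#upPivotal · 2^{1-N}`). FOUR STUBS:
* S1 `stub_sliceCoupling` (the lever; exact combinatorics, every `f`, every `q ∈ [0,1]`, `j ≤ N`; M): walking the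
  uniform increasing path, `|a_{ℓ+1} − a_ℓ| ≤ β_ℓ/((N−ℓ)C(N,ℓ))` (`β_ℓ` = # up-pivotal edges at level `ℓ`),
  `E_q f = Σ_ℓ B_{N,q}(ℓ) a_ℓ`, telescoping from `j`: `|E_q f − a_j f| ≤ Σ_{(x,i) ∈ upPivotal f}
  w_{q,j}(|x|)/((N−|x|)C(N,|x|))` with the HYBRID WEIGHT `w_{q,j}(i) = P[Bin(N,q) ≥ i+1]` (`i ≥ j`),
  `= P[Bin(N,q) ≤ i]` (`i < j`) (`hybridWeight`). This is the card's `RussoSliceIdentity`/`LadderIneq` with every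
  level charged its own binomial weight at ONE density (Filmus–Mossel Lemma 8.2–8.3 form, triage r1-1/2/3).
* S2 `stub_binomialHazard` (binomial analysis; M): at `q = j/N`, `0 < j < N`: `w_{q,j}(i)/((N−i)C(N,i)) ≤
  K₀/√j · q^{i+1}(1−q)^{N−1−i}` (log-concavity ⇒ monotone hazard ratios; modal mass `≥ 3/(20√j)` by Chebyshev +
  unimodality; `(i+1)C(N,i+1) = (N−i)C(N,i)`; `K₀ = 40/3` works, brute force needs `1.06` for `N ≤ 60`).
  S1+S2 ⇒ `|E_{j/N} f − a_j f| ≤ K₀ · (q·I_q f)/√j` (PROVED here: `hybrid_le`).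
* S3 `stub_andCoin` (exact identity, every `f`, `0 ≤ q ≤ 1/2`; S/M): `2q·I_q(f) = Σ_y μ_{2q}(y)·I_{1/2}(f_y)`,
  `f_y(z) = f(y ∧ z)` — biased influence is an average of UNBIASED influences of random 0-restrictions (the card's
  blow-up identity with the gadget `∧`; triage r1-1 sharpening; brute force exact).
* S4 `stub_boppana` (the analytic heart, HARDEST; M/L): an `acBasis` circuit of `acDepth ≤ d` has
  `I_{1/2} ≤ K_d (log(size+2))^{B_d}`, uniformly in the number of inputs (Boppana 1997 / LMN, from the in-tree Tal
  theorem `ACForm.tailWeight_le_tailBound` + `Circuit.exists_acForm` via `I = Σ_k W^{≥k}`).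
  S3+S4+`Circuit.exists_restrict` ⇒ `q·I_q(C) ≤ K_{d+1} (log(size+3))^{B}/2` (PROVED here: `biased_le`).
PROVED GLUE: S1–S4 ⇒ `SliceIndist` (`sliceIndist_of`; rate `polylog(j)/√j → 0`, `rate_eventually`): for
`j ≥ j₀(d,c,ε)` and `2j ≤ N`, no `acBasis` circuit of `acDepth ≤ d` and `≤ j^c` gates distinguishes slice `j` from
`μ_{j/N}` with advantage `> ε`, on ANY finite cube — the card's `Transfer` C⁺ (CLIQUE, `k`, `δ`, `Hyp` deleted);
and the REDUCTION `transfer : SliceIndist → CruxHyp → CruxConc` (the card's `Reduction`, formerly a fifth stub, now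
kernel-checked): given `Hyp` and `(d,c)` take `(k, δ_H)` from `Hyp d c`, answer with the same `k` and `δ := δ_H/2`;
`window_eventually` (central `j` ⇒ `j ≥ j₀`, `n ≤ 5j`, `2j ≤ C(n,2)`, eventually in `n`, uniformly in `j`; uses
`3 ≤ k`), `exists_xorClique_circuit` (`G = [C ≠ CLIQUE_k]` over `acBasis`, `acDepth ≤ d+4`, `≤ 2(|C|+C(n,k)+1)+5
≤ j^{2(c+k)+8}` gates — `exists_cliqueDNF_monotoneAC` + `acReal_and/or/neg`, `size_bound`), `sliceAvg_edge_eq` /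
`prodAvg_edge_eq` (`a_j(G) = sliceErr/sliceCard`, `E_{j/C(n,2)} G = gnpDisagreeProb`; `wt = edgeCount` rfl,
`card_edgeSet_top_fin`), then `Hyp` at `q = j/C(n,2) ∈ [0,1]` (window clause `|q·C(n,2) − m_k| = |j − m_k|`
verbatim). `SliceACZero_of` composes (conclusion = the route decl BY NAME; hypotheses = the `Registered.stub_*`
aliases); the closing `example : SliceACZero` feeds it the four registered stubs.

DISPROOF USED (`Cruxes/SliceACZero/Disproof.lean`, cdisprove v3, read in full): `not_innerConcNoWindow` /
`not_innerConcWindowAbove` — the centrality clause is consumed in `window_eventually` (to get `j → ∞`, which drives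
the rate, and `2j ≤ C(n,2)`, i.e. `q ≤ 1/2 ≤ 1`) and passed verbatim to `Hyp`'s window clause in `transfer`;
`not_innerConcNoBasis` — `acBasis` enters through S4 (an arbitrary gate has no influence bound) and through `Hyp`
applied to `C` itself; `not_innerConcNoError` — the error hypothesis is the input `a_j(G) ≤ δ`; Part II
(`lt_of_innerHyp`: `c < k`) and Part IV (`δ < 1/k!`) are inherited from `Hyp`'s witness (`k`, `δ_H/2`); Part III
`sliceTarget_of_concNoDepth` is respected: S4's `B_d` grows with `d`, the lever dies at unbounded depth. No Negative
lemma has landed under `Theorems/SliceACZero/Negative/` (nothing to import); no stub mentions CLIQUE, the window,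
the route decl or a refuted statement (`ledger negatives --problem PneNP`: 5 entries, none on slices / AC⁰
influence). Brute-force checks of S1 (exact, 360 random cases `N ≤ 6`), S2 (constant `≤ 1.06`, `N ≤ 60`), S3 (exact,
150 cases) in `checks_stubs.py` (evidence on the item).

Conventions (as in `Cruxes/CliqueExtLowerBound/Lines/event-sandwich-interpolation.lean`): `sorry` appears ONLY
inside the four `stub_*` theorems; the statements are the named `Prop`s `…Stmt`, restated verbatim by the stubs;
`Registered.stub_*` are their name-keyed aliases used as the hypotheses of `SliceACZero_of`.
-/

set_option linter.unusedVariables false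
set_option linter.dupNamespace false
set_option linter.unusedSimpArgs false

noncomputable section

namespace Summit.PneNP.PneNP.Cruxes.SliceACZero.RussoWindowLadder

open scoped BigOperators
open Finset Filter Literature.Computability.Complexity
open Literature.Computability.Complexity.LowDegree (tailWeight)
open Literature.Probability.RandomGraphs.LowDegree (sgn)
open Summit.PneNP.PneNP.Theses.OneSlice (SliceACZero)

/-! ### Vocabulary on a finite cube `{0,1}^ι` -/

section Vocabulary

variable {ι : Type} [Fintype ι] [DecidableEq ι]

/-- `|x|`: the number of ones of `x` (on edge vectors this is `edgeCount`, definitionally). [folklore] -/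
def wt (x : ι → Bool) : ℕ := #(univ.filter fun i => x i = true)

/-- The `μ_q` (product, `q`-biased) weight of a point: `q^{|x|}(1−q)^{N−|x|}` (on edge vectors: `gnpWeight`,
up to `Fintype.card = C(n,2)`). [folklore] -/
def prodWeight (q : ℝ) (x : ι → Bool) : ℝ := q ^ wt x * (1 - q) ^ (Fintype.card ι - wt x)

/-- `E_{μ_q}[f] = Pr_{μ_q}[f = 1]` as a finite sum (on edge vectors with `f = [C ≠ CLIQUE_k]`:
`gnpDisagreeProb`). [folklore] -/
def prodAvg (q : ℝ) (f : (ι → Bool) → Bool) : ℝ :=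
  ∑ x ∈ univ.filter (fun x : ι → Bool => f x = true), prodWeight q x

/-- `a_ℓ(f)`: the fraction of the Hamming slice `{|x| = ℓ}` (of size `C(N,ℓ)`; written as a count so that on edge
vectors the denominator is literally the Disproof's `sliceCard`) on which `f = 1`. [folklore] -/
def sliceAvg (f : (ι → Bool) → Bool) (ℓ : ℕ) : ℝ :=
  (#(univ.filter fun x : ι → Bool => wt x = ℓ ∧ f x = true) : ℝ) / (#(univ.filter fun x : ι → Bool => wt x = ℓ) : ℝ)

/-- The bichromatic UP-edges of `f`: pairs `(x, i)` with `x_i = 0` and `f x ≠ f (x with x_i := 1)`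
(each pivotal hypercube edge counted once, from its lower endpoint). [folklore] -/
def upPivotal (f : (ι → Bool) → Bool) : Finset ((ι → Bool) × ι) :=
  univ.filter fun p => p.1 p.2 = false ∧ f p.1 ≠ f (Function.update p.1 p.2 true)

/-- The UNSIGNED `μ_q`-total influence `I_q(f) = Σ_i Pr_{x ∼ μ_q}[i pivotal for f at x]`, written as the sum over
up-pivotal edges `(x,i)` of the `μ_q`-weight of `x` off coordinate `i`, `q^{|x|}(1−q)^{N−1−|x|}`; at `q = 1/2`
this is the ordinary total influence `I[f] = #upPivotal(f) · 2^{1−N}` (O'Donnell 2014 §2.2, §8.4). [folklore] -/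
def biasedInfluence (q : ℝ) (f : (ι → Bool) → Bool) : ℝ :=
  ∑ p ∈ upPivotal f, q ^ wt p.1 * (1 - q) ^ (Fintype.card ι - 1 - wt p.1)

end Vocabulary

/-- The binomial point mass `P[Bin(N,q) = ℓ] = C(N,ℓ) q^ℓ (1−q)^{N−ℓ}`. [folklore] -/
def binomPMF (N : ℕ) (q : ℝ) (ℓ : ℕ) : ℝ := (N.choose ℓ : ℝ) * q ^ ℓ * (1 - q) ^ (N - ℓ)

/-- The HYBRID WEIGHT of level `i` seen from slice `j`: the `Bin(N,q)`-mass strictly above `i` if `j ≤ i`, the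
mass at or below `i` if `i < j` (the mass of the levels `ℓ` whose monotone path from `j` to `ℓ` crosses the
edge layer `i → i+1`; Filmus–Mossel hybrid argument). [folklore] -/
def hybridWeight (N : ℕ) (q : ℝ) (j i : ℕ) : ℝ :=
  if j ≤ i then ∑ ℓ ∈ Finset.Ioc i N, binomPMF N q ℓ else ∑ ℓ ∈ Finset.range (i + 1), binomPMF N q ℓ

/-! ### The four stub STATEMENTS (named `Prop`s) and the line's C⁺ -/

/-- Statement of STUB 1 (slice coupling / Russo–Margulis read slice by slice). [folklore] -/
def SliceCouplingStmt : Prop :=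
  ∀ (ι : Type) [Fintype ι] [DecidableEq ι] (f : (ι → Bool) → Bool) (q : ℝ), 0 ≤ q → q ≤ 1 →
    ∀ j : ℕ, j ≤ Fintype.card ι →
      |prodAvg q f - sliceAvg f j| ≤
        ∑ p ∈ upPivotal f, hybridWeight (Fintype.card ι) q j (wt p.1) /
          (((Fintype.card ι - wt p.1 : ℕ) : ℝ) * ((Fintype.card ι).choose (wt p.1) : ℝ))

/-- Statement of STUB 2 (binomial hazard estimate at the matched density `q = j/N`). [folklore] -/
def BinomialHazardStmt : Prop :=
  ∃ K₀ : ℝ, 0 < K₀ ∧ ∀ (N j i : ℕ), 0 < j → j < N → i < N →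
    hybridWeight N ((j : ℝ) / N) j i / (((N - i : ℕ) : ℝ) * (N.choose i : ℝ)) ≤
      K₀ / Real.sqrt j * (((j : ℝ) / N) ^ (i + 1) * (1 - (j : ℝ) / N) ^ (N - 1 - i))

/-- Statement of STUB 3 (AND-coin identity: biased influence = average of unbiased influences of random
0-restrictions). [folklore] -/
def AndCoinStmt : Prop :=
  ∀ (ι : Type) [Fintype ι] [DecidableEq ι] (f : (ι → Bool) → Bool) (q : ℝ), 0 ≤ q → 2 * q ≤ 1 →
    2 * q * biasedInfluence q f =
      ∑ y : ι → Bool, prodWeight (2 * q) y * biasedInfluence (1 / 2) (fun z => f (fun i => y i && z i))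

/-- Boppana's bound (total influence of bounded-depth `acBasis` circuits is polylog in the size, uniformly in the
number of inputs) — no longer a stub: PROVED below (`boppana_of`) from STUB 4a + STUB 4b + the index transport. [folklore] -/
def BoppanaStmt : Prop :=
  ∀ d : ℕ, ∃ K : ℝ, ∃ B : ℕ, ∀ (ι : Type) [Fintype ι] [DecidableEq ι] (C : Circuit ι),
    C.IsOver acBasis → C.acDepth ≤ d →
      biasedInfluence (1 / 2) C.eval ≤ K * Real.log ((C.size : ℝ) + 2) ^ B

/-- Statement of STUB 4a (Fourier formula for the total influence on `{0,1}^m`: `I[f] = Σ_{k=1}^{m} W^{≥k}[sgn ∘ f]`,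
i.e. `Σ_S |S| f̂(S)²`, in the tree's `cubeFourierCoeff`/`tailWeight` normalisation; the left side is
`biasedInfluence (1/2) f` unfolded). [folklore] -/
def InfluenceFourierStmt : Prop :=
  ∀ (m : ℕ) (f : (Fin m → Bool) → Bool),
    (∑ p ∈ (univ.filter fun p : (Fin m → Bool) × Fin m =>
        p.1 p.2 = false ∧ f p.1 ≠ f (Function.update p.1 p.2 true)),
      (1 / 2 : ℝ) ^ #(univ.filter fun i => p.1 i = true) *
        (1 - 1 / 2 : ℝ) ^ (Fintype.card (Fin m) - 1 - #(univ.filter fun i => p.1 i = true))) =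
    ∑ k ∈ Finset.Icc 1 m, tailWeight (fun x => sgn (f x)) k

/-- Statement of STUB 4b (Tal/LMN/Boppana: the summed Fourier tails `Σ_{k=1}^{m} W^{≥k}` of an `acBasis` circuit of
`acDepth ≤ d` on `Fin m` are at most `K_d (log(|C|+2))^{B_d}`). [folklore] -/
def TalInfluenceStmt : Prop :=
  ∀ d : ℕ, ∃ K : ℝ, ∃ B : ℕ, ∀ (m : ℕ) (C : Circuit (Fin m)), C.IsOver acBasis → C.acDepth ≤ d →
    ∑ k ∈ Finset.Icc 1 m, tailWeight (fun x => sgn (C.eval x)) k ≤ K * Real.log ((C.size : ℝ) + 2) ^ B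

/-- **C⁺ of the line (`Transfer`)** — slice/product indistinguishability for small bounded-depth circuits on ANY
finite cube: for `j ≥ j₀(d,c,ε)` and `2j ≤ N`, an `acBasis` circuit of `acDepth ≤ d` with `≤ j^c` gates accepts
the uniform point of slice `j` and the `μ_{j/N}`-random point with probabilities within `ε`. CLIQUE, `k`, `δ` and
`Hyp` are gone; rate `polylog(j)/√j` (`sliceIndist_of`). [folklore] -/
def SliceIndist : Prop :=
  ∀ (d c : ℕ) (ε : ℝ), 0 < ε → ∃ j₀ : ℕ, ∀ (ι : Type) [Fintype ι] [DecidableEq ι] (j : ℕ),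
    j₀ ≤ j → 2 * j ≤ Fintype.card ι →
      ∀ C : Circuit ι, C.IsOver acBasis → C.acDepth ≤ d → C.size ≤ j ^ c →
        |prodAvg ((j : ℝ) / (Fintype.card ι : ℝ)) C.eval - sliceAvg C.eval j| ≤ ε

/-! ### Read-back of the crux in the vocabulary of `Cruxes/SliceACZero/Disproof.lean` (definitional) -/

/-- `m_k(n) = ⌊C(n,2) · n^{-2/(k-1)}⌋₊`, the critical edge count (as in the Disproof). [folklore] -/
def mk (n k : ℕ) : ℕ := ⌊((n.choose 2 : ℕ) : ℝ) * (n : ℝ) ^ (-(2 : ℝ) / ((k : ℝ) - 1))⌋₊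

/-- Size of the slice `G(n,j)` (as in the Disproof; `= C(C(n,2), j)`). [folklore] -/
def sliceCard (n j : ℕ) : ℕ :=
  #(univ.filter fun x : (⊤ : SimpleGraph (Fin n)).edgeSet → Bool => edgeCount x = j)

/-- Number of `j`-edge vectors on which `f` and `g` disagree (as in the Disproof). [folklore] -/
def sliceErr (n j : ℕ) (f g : ((⊤ : SimpleGraph (Fin n)).edgeSet → Bool) → Bool) : ℕ :=
  #(univ.filter fun x : (⊤ : SimpleGraph (Fin n)).edgeSet → Bool => edgeCount x = j ∧ f x ≠ g x)

/-- `Hyp`, the hypothesis of the crux: the fixed-δ, window-uniform, single-threshold average-case AC⁰ lower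
bound for `k`-CLIQUE on `G(n,q)` (Rossman 2008 strength), read back with `gnpDisagreeProb`/`cliqueFn`. [folklore] -/
def CruxHyp : Prop :=
  ∀ d c : ℕ, ∃ k : ℕ, 3 ≤ k ∧ ∃ δ : ℝ, 0 < δ ∧ ∀ᶠ n : ℕ in atTop, ∀ q : ℝ, 0 ≤ q → q ≤ 1 →
    |q * (n.choose 2 : ℕ) - (mk n k : ℝ)| ≤ (mk n k : ℝ) ^ ((3 : ℝ) / 4) →
    ∀ C : Circuit ((⊤ : SimpleGraph (Fin n)).edgeSet), C.IsOver acBasis → C.acDepth ≤ d →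
      gnpDisagreeProb n q C.eval (cliqueFn n k) ≤ δ → n ^ c < C.size

/-- `Conc`, the conclusion of the crux: the same bound on every central slice `G(n,j)`. [folklore] -/
def CruxConc : Prop :=
  ∀ d c : ℕ, ∃ k : ℕ, 3 ≤ k ∧ ∃ δ : ℝ, 0 < δ ∧ ∀ᶠ n : ℕ in atTop, ∀ j : ℕ,
    |(j : ℝ) - (mk n k : ℝ)| ≤ (mk n k : ℝ) ^ ((3 : ℝ) / 4) →
    ∀ C : Circuit ((⊤ : SimpleGraph (Fin n)).edgeSet), C.IsOver acBasis → C.acDepth ≤ d →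
      (sliceErr n j C.eval (cliqueFn n k) : ℝ) ≤ δ * sliceCard n j → n ^ c < C.size

/-- **Read-back.** The crux is literally `CruxHyp → CruxConc` (definitional unfolding of the route decl; same
read-back as the Disproof's `sliceACZero_iff`). [folklore] -/
theorem sliceACZero_iff : SliceACZero ↔ (CruxHyp → CruxConc) := Iff.rfl


/-! ### The five registered stubs (`sorry` lives ONLY in these five theorems) -/

/-- **Stub 1 — slice coupling (the lever; exact combinatorics, M).** For every Boolean `f` on `{0,1}^ι`
(`N = |ι|`), every `q ∈ [0,1]` and every `j ≤ N`:
`|E_{μ_q} f − a_j(f)| ≤ Σ_{(x,i) ∈ upPivotal f} w_{q,j}(|x|) / ((N − |x|)·C(N,|x|))`.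
Proof plan: `E_{μ_q} f = Σ_ℓ B_{N,q}(ℓ)·a_ℓ` (group `{f=1}` by weight; `Σ_ℓ B = 1`); the up-step coupling
`a_{ℓ+1} − a_ℓ = (#{up-edges from level ℓ with f(top)=1} − #{… f(bottom)=1})/((N−ℓ)C(N,ℓ))`
(every point of slice `ℓ` has `N−ℓ` up-neighbours, every point of slice `ℓ+1` has `ℓ+1` down-neighbours,
`(N−ℓ)C(N,ℓ) = (ℓ+1)C(N,ℓ+1)`), hence `|a_{ℓ+1} − a_ℓ| ≤ β_ℓ/((N−ℓ)C(N,ℓ))`; telescope `a_ℓ − a_j` along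
`[min(ℓ,j), max(ℓ,j))` and exchange sums: level `i` is crossed by exactly the `ℓ` of hybrid weight
`w_{q,j}(i)`. (= Filmus–Mossel, *Harmonicity and invariance on slices*, Lemma 8.2/8.3 unnormalised; Russo–Margulis
`I_q = N·Σ_ℓ P[Bin(N−1,q)=ℓ]·φ_ℓ` is the same double count. Brute-force exact for `N ≤ 8`: card + triage C1.)
[folklore] -/
theorem stub_sliceCoupling :
    ∀ (ι : Type) [Fintype ι] [DecidableEq ι] (f : (ι → Bool) → Bool) (q : ℝ), 0 ≤ q → q ≤ 1 →
      ∀ j : ℕ, j ≤ Fintype.card ι →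
        |prodAvg q f - sliceAvg f j| ≤
          ∑ p ∈ upPivotal f, hybridWeight (Fintype.card ι) q j (wt p.1) /
            (((Fintype.card ι - wt p.1 : ℕ) : ℝ) * ((Fintype.card ι).choose (wt p.1) : ℝ)) := by
  sorry

/-- **Stub 2 — binomial hazard estimate (M).** There is an absolute `K₀` (`40/3` works) with: for
`0 < j < N`, `q = j/N` and every level `i < N`,
`w_{q,j}(i)/((N−i)C(N,i)) ≤ (K₀/√j) · q^{i+1}(1−q)^{N−1−i}`, i.e. `w_{q,j}(i) ≤ K₀ (i+1) B_{N,q}(i+1)/√j`.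
Proof plan: `B_{N,q}` is log-concave (`B(ℓ)² ≥ B(ℓ−1)B(ℓ+1)` from the ratio `(N−ℓ)q/((ℓ+1)(1−q))`), so
`P[X ≥ m]/B(m)` is non-increasing and `P[X ≤ m]/B(m)` non-decreasing in `m`; `j` is a mode of `Bin(N, j/N)`
and `B(j±1) ≥ B(j)/2`; Chebyshev (variance `j(1−j/N) ≤ j` as a finite sum) + unimodality give
`B(j) ≥ (3/4)/(4√j+1) ≥ 3/(20√j)`; for `i ≥ j`: `P[X ≥ i+1] ≤ B(i+1)/B(j+1) ≤ (40/3)√j·B(i+1)` and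
`√j ≤ (i+1)/√j`; for `i < j`: `P[X ≤ i] ≤ (40/3)√j·B(i)` and `j·B(i) ≤ (i+1)B(i+1)` (ratio `(N−i)j/(N−j) ≥ j`);
finally `(i+1)C(N,i+1) = (N−i)C(N,i)` (`Nat.choose_succ_right_eq`). (Sharp constant `→ √(2π)`, triage r1-2 T1.)
[folklore] -/
theorem stub_binomialHazard :
    ∃ K₀ : ℝ, 0 < K₀ ∧ ∀ (N j i : ℕ), 0 < j → j < N → i < N →
      hybridWeight N ((j : ℝ) / N) j i / (((N - i : ℕ) : ℝ) * (N.choose i : ℝ)) ≤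
        K₀ / Real.sqrt j * (((j : ℝ) / N) ^ (i + 1) * (1 - (j : ℝ) / N) ^ (N - 1 - i)) := by
  sorry

/-- **Stub 3 — AND-coin identity (exact, S/M).** For every Boolean `f` on `{0,1}^ι` and `0 ≤ q ≤ 1/2`:
`2q · I_q(f) = Σ_y μ_{2q}(y) · I_{1/2}(f_y)`, `f_y(z) = f(y ∧ z)`.
Proof plan (double count): an up-pivotal edge `(z,i)` of `f_y` needs `y_i = 1`, and then `x = y ∧ z ↦ (x,i)` is
an up-pivotal edge of `f` with exactly `2^{N−|y|}` preimages `z`; summing `(2q)^{|y|}(1−2q)^{N−|y|}·2^{N−|y|}`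
over `y ⊇ x ∪ {i}` gives `2^N q^{|x|+1}(1−q)^{N−1−|x|}` (binomial theorem on the complement), and
`I_{1/2}(f_y) = #upPivotal(f_y)·2^{1−N}`. Equivalently: `x = y ∧ z`, `y ∼ μ_{2q}`, `z ∼ μ_{1/2}` realises
`x ∼ μ_q` (a polynomial identity in `q`, true for all real `q`; stated on `[0,1/2]`). (Rossman 2008 Lemma 4.5's
`∧`-gadget, applied to the influence functional; brute-force exact: triage r1-1 (2), r1-3 C3.) [folklore] -/
theorem stub_andCoin :
    ∀ (ι : Type) [Fintype ι] [DecidableEq ι] (f : (ι → Bool) → Bool) (q : ℝ), 0 ≤ q → 2 * q ≤ 1 →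
      2 * q * biasedInfluence q f =
        ∑ y : ι → Bool, prodWeight (2 * q) y *
          biasedInfluence (1 / 2) (fun z => f (fun i => y i && z i)) := by
  sorry

/-- **Stub 4a — Fourier formula for the total influence (exact identity, M).** For every Boolean `f` on `{0,1}^m`:
`I[f] = #upPivotal(f) · 2^{1−m} = Σ_{k=1}^{m} W^{≥k}[g]`, `g = sgn ∘ f` (`sgn b = if b then −1 else 1`,
`W^{≥k}[g] = tailWeight g k = Σ_{|S| ≥ k} ĝ(S)²`, `ĝ = cubeFourierCoeff g`). The left side is `biasedInfluence (1/2) f`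
written out (`(1/2)^{|x|} (1 − 1/2)^{m−1−|x|} = 2^{1−m}` on up-pivotal `(x,i)`).
Proof plan (O'Donnell 2014, Prop. 2.24 / Thm 2.38): for each `i`, `Inf_i[g] = Pr_x[f x ≠ f (x ⊕ e_i)] = E[(D_i g)²]` with
`D_i g (x) = (g(x^{i→0}) − g(x^{i→1}))/2 ∈ {0, ±1}`, whose expansion is `Σ_{S ∌ i} ĝ(S ∪ {i}) χ_S`, so by Parseval
(`sum_cubeFourierCoeff_sq`) `Inf_i[g] = Σ_{S ∋ i} ĝ(S)²`; summing over `i`: `Σ_S |S| ĝ(S)² = Σ_{k=1}^{m} Σ_{|S| ≥ k} ĝ(S)²`;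
and `Σ_i Pr_x[f x ≠ f(x ⊕ e_i)] = Σ_i 2·#{x : x_i = 0, f x ≠ f(x^{i→1})}/2^m`. Alternatively, directly:
`ĝ(S) = 2^{−m} Σ_x g(x) χ_S(x)` and `Σ_S |S| χ_S(x) χ_S(y)` computed coordinatewise. [cite: ODonnell2014, Proposition 2.24] -/
theorem stub_influenceFourier :
    ∀ (m : ℕ) (f : (Fin m → Bool) → Bool),
      (∑ p ∈ (univ.filter fun p : (Fin m → Bool) × Fin m =>
          p.1 p.2 = false ∧ f p.1 ≠ f (Function.update p.1 p.2 true)),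
        (1 / 2 : ℝ) ^ #(univ.filter fun i => p.1 i = true) *
          (1 - 1 / 2 : ℝ) ^ (Fintype.card (Fin m) - 1 - #(univ.filter fun i => p.1 i = true))) =
      ∑ k ∈ Finset.Icc 1 m, tailWeight (fun x => sgn (f x)) k := by
  sorry

/-- **Stub 4b — summed Fourier tails of bounded-depth circuits from the in-tree Tal theorem (M).** For every depth `d`
there are `K, B` with: every circuit `C` over `acBasis` on `Fin m` of `acDepth ≤ d` has
`Σ_{k=1}^{m} W^{≥k}[sgn ∘ C.eval] ≤ K · (log(|C|+2))^B` (Boppana 1997: `O((log s)^{d−1})`; LMN 1993: `O((log s)^d)`; any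
polylog suffices downstream).
Proof plan: `Circuit.exists_acForm` gives a layered formula `F` with `F.eval = C.eval`, height `≤ acDepth+1 ≤ d+1`,
width `≤ 1`, esize `≤ 2s` (`s = C.size`); apply `ACForm.tailWeight_le_tailBound` with `M := 2s+1 ≥ 1`, depth
parameter `d' := d+2 ≥ 2` (height `≤ d'`), `t := 1 ≤ logM M` (`one_le_logM`): `W^{≥k}[sgnEval F] ≤ tailBound (logM M) d' 1 k
= 8^{d'} · exp(−k ln 2/(cB^{d'} ℓ^{d'−2}))`, `ℓ = logM M = ⌊log₂(2s+2)⌋ ≤ 3 log(s+2)`; with `R := cB^{d'} ℓ^{d}/ln 2` and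
`W^{≥k} ≤ 1` (`tailWeight_le_one`, `sgnEval_sq`): `Σ_{k=1}^{m} W^{≥k} ≤ #{k : 8^{d'} e^{−k/R} > 1} + Σ_{j ≥ 0} e^{−j/R}
≤ R·d'·ln 8 + 1 + (R + 1)`, a polynomial of degree `d` in `ℓ`, hence `≤ K_d (log(s+2))^d`. (`Real.exp` geometric
series: `Real.summable_geometric_of_lt_one` / `tsum_geometric_of_lt_one` or a direct `Finset` bound; compare
`l1Level_le_of_tailWeight_le` in `FourierTails.lean`, which sums the same tails against `C(k', k)`.)
[cite: Tal2017, Theorem 3.6; Boppana1997] -/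
theorem stub_talInfluence :
    ∀ d : ℕ, ∃ K : ℝ, ∃ B : ℕ, ∀ (m : ℕ) (C : Circuit (Fin m)), C.IsOver acBasis → C.acDepth ≤ d →
      ∑ k ∈ Finset.Icc 1 m, tailWeight (fun x => sgn (C.eval x)) k ≤ K * Real.log ((C.size : ℝ) + 2) ^ B := by
  sorry

/-! ### Name-keyed aliases of the five statements (the hypotheses of the composition) -/
namespace Registered

/-- Alias of `SliceCouplingStmt` keyed by the registered stub name. [folklore] -/
abbrev stub_sliceCoupling : Prop := SliceCouplingStmt
/-- Alias of `BinomialHazardStmt` keyed by the registered stub name. [folklore] -/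
abbrev stub_binomialHazard : Prop := BinomialHazardStmt
/-- Alias of `AndCoinStmt` keyed by the registered stub name. [folklore] -/
abbrev stub_andCoin : Prop := AndCoinStmt
/-- Alias of `InfluenceFourierStmt` keyed by the registered stub name. [folklore] -/
abbrev stub_influenceFourier : Prop := InfluenceFourierStmt
/-- Alias of `TalInfluenceStmt` keyed by the registered stub name. [folklore] -/
abbrev stub_talInfluence : Prop := TalInfluenceStmt

end Registered

/-! ### Proved glue: elementary facts on the cube -/

section Glue

variable {ι : Type} [Fintype ι]

/-- A point with a zero coordinate has weight `< N`. [folklore] -/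
theorem wt_lt_card_of_mem_upPivotal [DecidableEq ι] {f : (ι → Bool) → Bool} {p : (ι → Bool) × ι}
    (hp : p ∈ upPivotal f) : wt p.1 < Fintype.card ι := by
  rw [upPivotal, mem_filter] at hp
  rw [wt, ← Finset.card_univ (α := ι)]
  refine Finset.card_lt_card (Finset.filter_ssubset.2 ⟨p.2, mem_univ _, ?_⟩)
  rw [hp.2.1]
  exact Bool.false_ne_true

/-- `μ_q` weights are nonnegative for `q ∈ [0,1]`. [folklore] -/
theorem prodWeight_nonneg {q : ℝ} (hq0 : 0 ≤ q) (hq1 : q ≤ 1) (x : ι → Bool) : 0 ≤ prodWeight q x :=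
  mul_nonneg (pow_nonneg hq0 _) (pow_nonneg (sub_nonneg.2 hq1) _)

/-- Product form of the `μ_q` weight. [folklore] -/
theorem prodWeight_eq_prod (q : ℝ) (x : ι → Bool) :
    prodWeight q x = ∏ i, (if x i = true then q else 1 - q) := by
  have hc : #(univ.filter fun i => ¬ x i = true) = Fintype.card ι - wt x := by
    have h := Finset.card_filter_add_card_filter_not (s := (univ : Finset ι)) (fun i => x i = true)
    rw [Finset.card_univ] at h
    rw [wt]
    omega
  rw [Finset.prod_ite, Finset.prod_const, Finset.prod_const, hc]
  rfl

/-- Total mass `Σ_x μ_q(x) = 1`. [folklore] -/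
theorem sum_prodWeight [DecidableEq ι] (q : ℝ) : ∑ x : ι → Bool, prodWeight q x = 1 := by
  simp_rw [prodWeight_eq_prod]
  rw [sum_boolVec_prod (fun _ b => if b = true then q else 1 - q)]
  simp

end Glue

/-! ### Proved glue: S1 + S2 ⇒ the hybrid inequality `|E_{j/N} f − a_j f| ≤ K₀ (q I_q f)/√j` -/

/-- **S1 + S2.** At the matched density `q = j/N` (`0 < j < N`): `|E_q f − a_j f| ≤ (K₀/√j)·q·I_q(f)`.
[folklore] -/
theorem hybrid_le (h1 : SliceCouplingStmt) {K₀ : ℝ}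
    (h2 : ∀ (N j i : ℕ), 0 < j → j < N → i < N →
      hybridWeight N ((j : ℝ) / N) j i / (((N - i : ℕ) : ℝ) * (N.choose i : ℝ)) ≤
        K₀ / Real.sqrt j * (((j : ℝ) / N) ^ (i + 1) * (1 - (j : ℝ) / N) ^ (N - 1 - i)))
    {ι : Type} [Fintype ι] [DecidableEq ι] (f : (ι → Bool) → Bool) {j : ℕ} (hj0 : 0 < j)
    (hjN : j < Fintype.card ι) :
    |prodAvg ((j : ℝ) / (Fintype.card ι : ℝ)) f - sliceAvg f j| ≤
      K₀ / Real.sqrt j * ((j : ℝ) / (Fintype.card ι : ℝ)) *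
        biasedInfluence ((j : ℝ) / (Fintype.card ι : ℝ)) f := by
  have hNpos : (0 : ℝ) < (Fintype.card ι : ℝ) := by exact_mod_cast hj0.trans hjN
  have hq0 : 0 ≤ (j : ℝ) / (Fintype.card ι : ℝ) := div_nonneg (Nat.cast_nonneg _) hNpos.le
  have hq1 : (j : ℝ) / (Fintype.card ι : ℝ) ≤ 1 := by
    rw [div_le_one hNpos]; exact_mod_cast hjN.le
  calc |prodAvg ((j : ℝ) / (Fintype.card ι : ℝ)) f - sliceAvg f j|
      ≤ ∑ p ∈ upPivotal f, hybridWeight (Fintype.card ι) ((j : ℝ) / (Fintype.card ι : ℝ)) j (wt p.1) /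
          (((Fintype.card ι - wt p.1 : ℕ) : ℝ) * ((Fintype.card ι).choose (wt p.1) : ℝ)) :=
        h1 ι f _ hq0 hq1 j hjN.le
    _ ≤ ∑ p ∈ upPivotal f, K₀ / Real.sqrt j *
          (((j : ℝ) / (Fintype.card ι : ℝ)) ^ (wt p.1 + 1) *
            (1 - (j : ℝ) / (Fintype.card ι : ℝ)) ^ (Fintype.card ι - 1 - wt p.1)) :=
        Finset.sum_le_sum fun p hp => h2 (Fintype.card ι) j (wt p.1) hj0 hjN (wt_lt_card_of_mem_upPivotal hp)
    _ = K₀ / Real.sqrt j * ((j : ℝ) / (Fintype.card ι : ℝ)) *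
          biasedInfluence ((j : ℝ) / (Fintype.card ι : ℝ)) f := by
        rw [biasedInfluence, Finset.mul_sum]
        refine Finset.sum_congr rfl fun p _ => ?_
        ring

/-! ### Proved glue: S3 + S4 + restrictions ⇒ the biased influence budget `q·I_q(C) ≤ K (log(|C|+3))^B / 2` -/

/-- **S3 + S4.** For `C` over `acBasis` of `acDepth ≤ d` and `0 ≤ q ≤ 1/2`: `q·I_q(C) ≤ (K/2)(log(|C|+3))^B`,
where `(K, B)` are Boppana constants for depth `d+1` (restrictions may turn `C` into a one-gate constant). Uses
`Circuit.exists_restrict` (the 0-restriction `y ∧ ·` is a circuit of size `≤ max |C| 1`, `acDepth ≤ max d 1`) and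
`Σ_y μ_{2q}(y) = 1`. [folklore] -/
theorem biased_le (h3 : AndCoinStmt) {d B : ℕ} {K : ℝ} (hK : 0 ≤ K)
    (h4 : ∀ (ι : Type) [Fintype ι] [DecidableEq ι] (C : Circuit ι), C.IsOver acBasis →
      C.acDepth ≤ d + 1 → biasedInfluence (1 / 2) C.eval ≤ K * Real.log ((C.size : ℝ) + 2) ^ B)
    {ι : Type} [Fintype ι] [DecidableEq ι] (C : Circuit ι) (hC : C.IsOver acBasis)
    (hd : C.acDepth ≤ d) {q : ℝ} (hq0 : 0 ≤ q) (hq : 2 * q ≤ 1) :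
    q * biasedInfluence q C.eval ≤ K / 2 * Real.log ((C.size : ℝ) + 3) ^ B := by
  have key : ∀ y : ι → Bool,
      biasedInfluence (1 / 2) (fun z => C.eval (fun i => y i && z i)) ≤
        K * Real.log ((C.size : ℝ) + 3) ^ B := by
    intro y
    obtain ⟨C', hB', hs', hd', he'⟩ :=
      C.exists_restrict hC (fun i => if y i = true then none else some false)
    have hfun : (fun z => C.eval (fun i => y i && z i)) = C'.eval := by
      funext z
      rw [he']
      congr 1
      funext i
      cases hy : y i <;> simp [restrictInput, hy]
    rw [hfun]
    have hd1 : C'.acDepth ≤ d + 1 := hd'.trans (max_le (hd.trans (Nat.le_succ d)) (by omega))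
    refine (h4 ι C' hB' hd1).trans ?_
    have hsz0 : (0 : ℝ) ≤ (C'.size : ℝ) := Nat.cast_nonneg _
    have hsz : (C'.size : ℝ) + 2 ≤ (C.size : ℝ) + 3 := by
      have h1 : C'.size ≤ C.size + 1 := hs'.trans (max_le (Nat.le_succ _) (by omega))
      have h2 : (C'.size : ℝ) ≤ (C.size : ℝ) + 1 := by exact_mod_cast h1
      linarith
    exact mul_le_mul_of_nonneg_left
      (pow_le_pow_left₀ (Real.log_nonneg (by linarith)) (Real.log_le_log (by linarith) hsz) B) hK
  have hw0 : ∀ y : ι → Bool, 0 ≤ prodWeight (2 * q) y := fun y =>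
    prodWeight_nonneg (by linarith) hq y
  have hsum : 2 * q * biasedInfluence q C.eval ≤ K * Real.log ((C.size : ℝ) + 3) ^ B := by
    rw [h3 ι C.eval q hq0 hq]
    calc ∑ y : ι → Bool, prodWeight (2 * q) y *
          biasedInfluence (1 / 2) (fun z => C.eval (fun i => y i && z i))
        ≤ ∑ y : ι → Bool, prodWeight (2 * q) y * (K * Real.log ((C.size : ℝ) + 3) ^ B) :=
          Finset.sum_le_sum fun y _ => mul_le_mul_of_nonneg_left (key y) (hw0 y)
      _ = K * Real.log ((C.size : ℝ) + 3) ^ B := by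
          rw [← Finset.sum_mul, sum_prodWeight, one_mul]
  linarith

/-! ### Proved glue: index transport and Boppana's bound from S4a + S4b -/

section Transport

variable {ι κ : Type} [Fintype ι] [Fintype κ]

/-- The weight is invariant under renaming the coordinates along an equivalence. [folklore] -/
theorem wt_comp_equiv (e : ι ≃ κ) (x : ι → Bool) : wt (fun k => x (e.symm k)) = wt x := by
  unfold wt
  rw [← Finset.card_map e.toEmbedding]
  congr 1
  ext k
  simp only [Finset.mem_filter, Finset.mem_univ, true_and, Finset.mem_map_equiv, Equiv.coe_toEmbedding]

variable [DecidableEq ι] [DecidableEq κ]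

/-- **Index transport.** The biased influence is invariant under renaming the coordinates along an equivalence
`e : ι ≃ κ` (the up-pivotal edges correspond under `(x, i) ↦ (x ∘ e⁻¹, e i)`, weights and `N` are preserved). [folklore] -/
theorem biasedInfluence_comp_equiv (e : ι ≃ κ) (q : ℝ) (g : (ι → Bool) → Bool) :
    biasedInfluence q (fun u : κ → Bool => g (fun i => u (e i))) = biasedInfluence q g := by
  classical
  have hcard : Fintype.card κ = Fintype.card ι := Fintype.card_congr e.symm
  let ψ : (ι → Bool) × ι ≃ (κ → Bool) × κ := (e.arrowCongr (Equiv.refl Bool)).prodCongr e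
  have hψ : ∀ p : (ι → Bool) × ι, ψ p = (fun k => p.1 (e.symm k), e p.2) := fun p => rfl
  have hupd : ∀ (x : ι → Bool) (i i' : ι),
      Function.update (fun k => x (e.symm k)) (e i) true (e i') = Function.update x i true i' := by
    intro x i i'
    rw [Function.update_apply_equiv_apply]
    simp [Function.comp_def]
  have hmem : ∀ p : (ι → Bool) × ι,
      p ∈ upPivotal g ↔ ψ p ∈ upPivotal (fun u : κ → Bool => g (fun i => u (e i))) := by
    intro p
    rw [hψ]
    simp only [upPivotal, Finset.mem_filter, Finset.mem_univ, true_and, Equiv.symm_apply_apply, hupd]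
  have hw : ∀ p : (ι → Bool) × ι, wt (ψ p).1 = wt p.1 := fun p => by rw [hψ]; exact wt_comp_equiv e p.1
  symm
  unfold biasedInfluence
  refine Finset.sum_equiv ψ hmem (fun p _ => ?_)
  rw [hw, hcard]

end Transport

/-- **S4a + S4b ⇒ Boppana's bound on any finite index type.** Transport `C` to `Fin N` along `Fintype.equivFin ι`
(`Circuit.mapInputs`: same size, basis, `acDepth`; `eval_mapInputs`), rewrite the influence by the Fourier formula (S4a)
and bound the summed tails by S4b. [folklore] -/
theorem boppana_of (hF : InfluenceFourierStmt) (hT : TalInfluenceStmt) : BoppanaStmt := by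
  intro d
  obtain ⟨K, B, hKB⟩ := hT d
  refine ⟨K, B, fun ι _ _ C hC hd => ?_⟩
  set e := Fintype.equivFin ι with he
  have hev : (C.mapInputs e).eval = fun u => C.eval (fun i => u (e i)) := funext (Circuit.eval_mapInputs e C)
  have h1 : biasedInfluence (1 / 2) C.eval = biasedInfluence (1 / 2) (C.mapInputs e).eval := by
    rw [hev, biasedInfluence_comp_equiv e]
  have h2 : biasedInfluence (1 / 2) (C.mapInputs e).eval =
      ∑ k ∈ Finset.Icc 1 (Fintype.card ι), tailWeight (fun x => sgn ((C.mapInputs e).eval x)) k :=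
    hF (Fintype.card ι) (C.mapInputs e).eval
  have h3 := hKB (Fintype.card ι) (C.mapInputs e) (hC.mapInputs e) (by simpa using hd)
  rw [Circuit.size_mapInputs] at h3
  rw [h1, h2]
  exact h3

/-! ### Proved glue: the rate `polylog(j)/√j → 0` -/

/-- For fixed `c, B` and `M ≥ 0`: `M·(log(j^c+3))^B/√j ≤ ε` for all large `j`. [folklore] -/
theorem rate_eventually (c B : ℕ) {M ε : ℝ} (hM : 0 ≤ M) (hε : 0 < ε) :
    ∃ j₀ : ℕ, 1 ≤ j₀ ∧ ∀ j : ℕ, j₀ ≤ j →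
      M * Real.log ((j : ℝ) ^ c + 3) ^ B / Real.sqrt j ≤ ε := by
  have hlo := isLittleO_log_rpow_rpow_atTop (B : ℝ) (by norm_num : (0 : ℝ) < 1 / 2)
  have ht : Tendsto (fun j : ℕ => Real.log (j : ℝ) ^ (B : ℝ) / (j : ℝ) ^ (1 / 2 : ℝ)) atTop (nhds 0) :=
    hlo.tendsto_div_nhds_zero.comp tendsto_natCast_atTop_atTop
  set L : ℝ := M * ((c : ℝ) + 2) ^ B + 1 with hL
  have hLpos : 0 < L := by rw [hL]; positivity
  have hε' : 0 < ε / L := div_pos hε hLpos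
  obtain ⟨j₁, hj₁⟩ := eventually_atTop.1 (ht.eventually (gt_mem_nhds hε'))
  refine ⟨max j₁ 2, le_max_of_le_right (by norm_num), fun j hj => ?_⟩
  have hj2 : 2 ≤ j := (le_max_right _ _).trans hj
  have hjr : (2 : ℝ) ≤ j := by exact_mod_cast hj2
  have hjpos : (0 : ℝ) < j := by linarith
  have hratio := hj₁ j ((le_max_left _ _).trans hj)
  rw [Real.rpow_natCast, ← Real.sqrt_eq_rpow] at hratio
  have hlogj : 0 ≤ Real.log j := Real.log_nonneg (by linarith)
  have hpow_le : (j : ℝ) ^ c + 3 ≤ (j : ℝ) ^ (c + 2) := by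
    have h1 : (1 : ℝ) ≤ (j : ℝ) ^ c := one_le_pow₀ (by linarith)
    have h2 : (j : ℝ) ^ (c + 2) = (j : ℝ) ^ c * ((j : ℝ) * j) := by ring
    have h3 : (4 : ℝ) ≤ (j : ℝ) * j := by nlinarith
    have h4 : (j : ℝ) ^ c * 4 ≤ (j : ℝ) ^ c * ((j : ℝ) * j) :=
      mul_le_mul_of_nonneg_left h3 (zero_le_one.trans h1)
    rw [h2]
    linarith
  have hlog_le : Real.log ((j : ℝ) ^ c + 3) ≤ ((c : ℝ) + 2) * Real.log j := by
    calc Real.log ((j : ℝ) ^ c + 3) ≤ Real.log ((j : ℝ) ^ (c + 2)) :=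
          Real.log_le_log (by positivity) hpow_le
      _ = ((c + 2 : ℕ) : ℝ) * Real.log j := Real.log_pow _ _
      _ = ((c : ℝ) + 2) * Real.log j := by push_cast; ring
  have hjc0 : (0 : ℝ) ≤ (j : ℝ) ^ c := by positivity
  have hlog0 : 0 ≤ Real.log ((j : ℝ) ^ c + 3) := Real.log_nonneg (by linarith)
  have hpowB : Real.log ((j : ℝ) ^ c + 3) ^ B ≤ ((c : ℝ) + 2) ^ B * Real.log j ^ B := by
    rw [← mul_pow]; exact pow_le_pow_left₀ hlog0 hlog_le B
  have hsqrt : 0 < Real.sqrt j := Real.sqrt_pos.2 hjpos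
  calc M * Real.log ((j : ℝ) ^ c + 3) ^ B / Real.sqrt j
      ≤ M * (((c : ℝ) + 2) ^ B * Real.log j ^ B) / Real.sqrt j :=
        div_le_div_of_nonneg_right (mul_le_mul_of_nonneg_left hpowB hM) hsqrt.le
    _ = (M * ((c : ℝ) + 2) ^ B) * (Real.log j ^ B / Real.sqrt j) := by ring
    _ ≤ L * (Real.log j ^ B / Real.sqrt j) :=
        mul_le_mul_of_nonneg_right (by rw [hL]; linarith) (div_nonneg (pow_nonneg hlogj _) hsqrt.le)
    _ ≤ L * (ε / L) := mul_le_mul_of_nonneg_left hratio.le hLpos.le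
    _ = ε := mul_div_cancel₀ ε hLpos.ne'

/-! ### Proved glue: S1–S4 ⇒ `SliceIndist` -/

/-- **S1 + S2 + S3 + S4 ⇒ C⁺.** With `(K₀)` from S2 and `(K, B)` from S4 at depth `d+1`:
`|E_{j/N} C − a_j C| ≤ (K₀/√j)·q·I_q(C) ≤ K₀·(max K 0)/2 · (log(j^c+3))^B/√j ≤ ε` for `j ≥ j₀`. [folklore] -/
theorem sliceIndist_of (h1 : SliceCouplingStmt) (h2 : BinomialHazardStmt) (h3 : AndCoinStmt)
    (h4 : BoppanaStmt) : SliceIndist := by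
  intro d c ε hε
  obtain ⟨K₀, hK₀, h2'⟩ := h2
  obtain ⟨K, B, h4'⟩ := h4 (d + 1)
  have hK' : 0 ≤ max K 0 := le_max_right _ _
  have h4'' : ∀ (ι : Type) [Fintype ι] [DecidableEq ι] (C : Circuit ι), C.IsOver acBasis →
      C.acDepth ≤ d + 1 → biasedInfluence (1 / 2) C.eval ≤ max K 0 * Real.log ((C.size : ℝ) + 2) ^ B := by
    intro ι _ _ C hC hdC
    refine (h4' ι C hC hdC).trans (mul_le_mul_of_nonneg_right (le_max_left _ _) ?_)
    have : (0 : ℝ) ≤ (C.size : ℝ) := Nat.cast_nonneg _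
    exact pow_nonneg (Real.log_nonneg (by linarith)) _
  obtain ⟨j₀, hj₀, hrate⟩ :=
    rate_eventually c B (M := K₀ * (max K 0 / 2)) (mul_nonneg hK₀.le (div_nonneg hK' two_pos.le)) hε
  refine ⟨j₀, fun ι _ _ j hj h2j C hC hd hs => ?_⟩
  have hj1 : 0 < j := by omega
  have hjN : j < Fintype.card ι := by omega
  have hNpos : (0 : ℝ) < (Fintype.card ι : ℝ) := by exact_mod_cast hj1.trans hjN
  have hq0 : 0 ≤ (j : ℝ) / (Fintype.card ι : ℝ) := div_nonneg (Nat.cast_nonneg _) hNpos.le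
  have hq2 : 2 * ((j : ℝ) / (Fintype.card ι : ℝ)) ≤ 1 := by
    rw [mul_div_assoc', div_le_one hNpos]; exact_mod_cast h2j
  have hA := hybrid_le h1 h2' C.eval hj1 hjN
  have hB := biased_le h3 hK' h4'' C hC hd hq0 hq2
  have hsqrt : 0 ≤ K₀ / Real.sqrt j := div_nonneg hK₀.le (Real.sqrt_nonneg _)
  have hsize0 : (0 : ℝ) ≤ (C.size : ℝ) := Nat.cast_nonneg _
  have hsize : (C.size : ℝ) + 3 ≤ (j : ℝ) ^ c + 3 := by
    have : (C.size : ℝ) ≤ (j : ℝ) ^ c := by exact_mod_cast hs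
    linarith
  calc |prodAvg ((j : ℝ) / (Fintype.card ι : ℝ)) C.eval - sliceAvg C.eval j|
      ≤ K₀ / Real.sqrt j * ((j : ℝ) / (Fintype.card ι : ℝ)) *
          biasedInfluence ((j : ℝ) / (Fintype.card ι : ℝ)) C.eval := hA
    _ = K₀ / Real.sqrt j * (((j : ℝ) / (Fintype.card ι : ℝ)) *
          biasedInfluence ((j : ℝ) / (Fintype.card ι : ℝ)) C.eval) := by ring
    _ ≤ K₀ / Real.sqrt j * (max K 0 / 2 * Real.log ((C.size : ℝ) + 3) ^ B) :=
        mul_le_mul_of_nonneg_left hB hsqrt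
    _ ≤ K₀ / Real.sqrt j * (max K 0 / 2 * Real.log ((j : ℝ) ^ c + 3) ^ B) := by
        refine mul_le_mul_of_nonneg_left (mul_le_mul_of_nonneg_left ?_ (div_nonneg hK' two_pos.le)) hsqrt
        exact pow_le_pow_left₀ (Real.log_nonneg (by linarith)) (Real.log_le_log (by linarith) hsize) B
    _ = K₀ * (max K 0 / 2) * Real.log ((j : ℝ) ^ c + 3) ^ B / Real.sqrt j := by ring
    _ ≤ ε := hrate j hj


/-! ### Proved glue: the transfer `SliceIndist → Hyp → Conc` (the reduction; formerly stub S5) -/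

section Transfer

/-- Edge variables of `K_n` (the input type of the crux's circuits). [folklore] -/
abbrev Edge (n : ℕ) : Type := (⊤ : SimpleGraph (Fin n)).edgeSet

/-- `M^{3/4} ≤ M/2` for `M ≥ 16`. [folklore] -/
theorem rpow_three_quarters_le_half {M : ℝ} (hM : 16 ≤ M) : M ^ ((3 : ℝ) / 4) ≤ M / 2 := by
  have hM0 : 0 < M := by linarith
  have h1 : M ^ ((3 : ℝ) / 4) = M * M ^ (-(1 : ℝ) / 4) := by
    rw [show (3 : ℝ) / 4 = 1 + -(1 : ℝ) / 4 by norm_num, Real.rpow_add hM0, Real.rpow_one]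
  have h2 : M ^ (-(1 : ℝ) / 4) ≤ (16 : ℝ) ^ (-(1 : ℝ) / 4) :=
    Real.rpow_le_rpow_of_nonpos (by norm_num) hM (by norm_num)
  have h3 : (16 : ℝ) ^ (-(1 : ℝ) / 4) = 1 / 2 := by
    have h16 : (16 : ℝ) = (2 : ℝ) ^ (4 : ℝ) := by
      rw [show (4 : ℝ) = ((4 : ℕ) : ℝ) by norm_num, Real.rpow_natCast]; norm_num
    rw [h16, ← Real.rpow_mul (by norm_num : (0 : ℝ) ≤ 2),
      show (4 : ℝ) * (-(1 : ℝ) / 4) = -1 by norm_num, Real.rpow_neg_one]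
    norm_num
  rw [h1]
  calc M * M ^ (-(1 : ℝ) / 4) ≤ M * (1 / 2) := by
        rw [← h3]; exact mul_le_mul_of_nonneg_left h2 hM0.le
    _ = M / 2 := by ring

/-- **Window arithmetic** (this is where `3 ≤ k` and the centrality clause — load-bearing by the Disproof's
`not_innerConcNoWindow` / `not_innerConcWindowAbove` — are used): eventually in `n`, every central `j`
(`|j − m_k(n)| ≤ m_k(n)^{3/4}`) satisfies `j₀ ≤ j`, `n ≤ 5j` and `2j ≤ C(n,2)`. Proof: `m_k ≥ C(n,2)·n^{-1} − 1 =
(n−3)/2` (`n^{-2/(k-1)} ≥ n^{-1}`), `m_k^{3/4} ≤ m_k/2` once `m_k ≥ 16`, and `m_k ≤ C(n,2)·n^{-2/(k-1)} ≤ C(n,2)/4`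
eventually. [folklore] -/
theorem window_eventually {k : ℕ} (hk : 3 ≤ k) (j₀ : ℕ) :
    ∀ᶠ n : ℕ in atTop, ∀ j : ℕ, |(j : ℝ) - (mk n k : ℝ)| ≤ (mk n k : ℝ) ^ ((3 : ℝ) / 4) →
      j₀ ≤ j ∧ n ≤ 5 * j ∧ 2 * j ≤ n.choose 2 := by
  have hk1 : (2 : ℝ) ≤ (k : ℝ) - 1 := by
    have : (3 : ℝ) ≤ k := by exact_mod_cast hk
    linarith
  have hαpos : 0 < (2 : ℝ) / ((k : ℝ) - 1) := div_pos two_pos (by linarith)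
  have hα1 : (2 : ℝ) / ((k : ℝ) - 1) ≤ 1 := by rw [div_le_one (by linarith)]; exact hk1
  have hr : Tendsto (fun n : ℕ => (n : ℝ) ^ (-(2 : ℝ) / ((k : ℝ) - 1))) atTop (nhds 0) := by
    have := (tendsto_rpow_neg_atTop hαpos).comp tendsto_natCast_atTop_atTop
    refine this.congr fun n => ?_
    rw [Function.comp_apply, neg_div]
  filter_upwards [hr.eventually (gt_mem_nhds (by norm_num : (0 : ℝ) < 1 / 4)),
    eventually_ge_atTop (max 35 (4 * j₀ + 3))] with n hn4 hn j hj
  have hn35 : 35 ≤ n := (le_max_left _ _).trans hn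
  have hnj₀ : 4 * j₀ + 3 ≤ n := (le_max_right _ _).trans hn
  have hnR : (35 : ℝ) ≤ n := by exact_mod_cast hn35
  have hnpos : (0 : ℝ) < n := by linarith
  have hn0 : (n : ℝ) ≠ 0 := hnpos.ne'
  have hr0 : 0 ≤ (n : ℝ) ^ (-(2 : ℝ) / ((k : ℝ) - 1)) := Real.rpow_nonneg hnpos.le _
  have hN : ((n.choose 2 : ℕ) : ℝ) = n * (n - 1) / 2 := Nat.cast_choose_two (K := ℝ) n
  have hNr0 : 0 ≤ ((n.choose 2 : ℕ) : ℝ) * (n : ℝ) ^ (-(2 : ℝ) / ((k : ℝ) - 1)) :=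
    mul_nonneg (Nat.cast_nonneg _) hr0
  -- `m_k` against `C(n,2) · n^{-2/(k-1)}`
  have hm_le : (mk n k : ℝ) ≤ ((n.choose 2 : ℕ) : ℝ) * (n : ℝ) ^ (-(2 : ℝ) / ((k : ℝ) - 1)) :=
    Nat.floor_le hNr0
  have hm_ge : ((n.choose 2 : ℕ) : ℝ) * (n : ℝ) ^ (-(2 : ℝ) / ((k : ℝ) - 1)) - 1 < (mk n k : ℝ) :=
    Nat.sub_one_lt_floor _
  -- `C(n,2) · n^{-2/(k-1)} ≥ (n-1)/2`
  have hr_ge : (n : ℝ) ^ (-(1 : ℝ)) ≤ (n : ℝ) ^ (-(2 : ℝ) / ((k : ℝ) - 1)) := by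
    refine Real.rpow_le_rpow_of_exponent_le (by linarith) ?_
    rw [neg_div, neg_le_neg_iff]; exact hα1
  have hNr_ge : ((n : ℝ) - 1) / 2 ≤ ((n.choose 2 : ℕ) : ℝ) * (n : ℝ) ^ (-(2 : ℝ) / ((k : ℝ) - 1)) := by
    calc ((n : ℝ) - 1) / 2 = ((n.choose 2 : ℕ) : ℝ) * (n : ℝ) ^ (-(1 : ℝ)) := by
          rw [hN, Real.rpow_neg_one]; field_simp
      _ ≤ _ := mul_le_mul_of_nonneg_left hr_ge (Nat.cast_nonneg _)
  -- `C(n,2) · n^{-2/(k-1)} ≤ C(n,2)/4`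
  have hNr_le : ((n.choose 2 : ℕ) : ℝ) * (n : ℝ) ^ (-(2 : ℝ) / ((k : ℝ) - 1)) ≤ ((n.choose 2 : ℕ) : ℝ) / 4 := by
    have := mul_le_mul_of_nonneg_left hn4.le (Nat.cast_nonneg (n.choose 2) : (0 : ℝ) ≤ _)
    linarith
  have hm16 : (16 : ℝ) ≤ (mk n k : ℝ) := by linarith
  have h34 := rpow_three_quarters_le_half hm16
  obtain ⟨hj1, hj2⟩ := abs_sub_le_iff.1 hj
  have hjlo : (mk n k : ℝ) / 2 ≤ j := by linarith
  have hjhi : (j : ℝ) ≤ 3 * (mk n k : ℝ) / 2 := by linarith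
  refine ⟨?_, ?_, ?_⟩
  · have h' : ((4 * j₀ + 3 : ℕ) : ℝ) ≤ n := by exact_mod_cast hnj₀
    push_cast at h'
    have : (j₀ : ℝ) ≤ j := by linarith
    exact_mod_cast this
  · have : (n : ℝ) ≤ 5 * j := by linarith
    exact_mod_cast this
  · have : (2 * j : ℝ) ≤ ((n.choose 2 : ℕ) : ℝ) := by linarith
    exact_mod_cast this

/-- Size bookkeeping for the test circuit: `2(s + C(n,k) + 1) + 5 ≤ j^{2(c+k)+8}` when `s ≤ n^c`,
`n ≤ 5j`, `j ≥ 5`, `n ≥ 2`. [folklore] -/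
theorem size_bound {n j c k s : ℕ} (hn : 2 ≤ n) (hj : 5 ≤ j) (hnj : n ≤ 5 * j) (hs : s ≤ n ^ c) :
    2 * (s + (n.choose k + 1)) + 5 ≤ j ^ (2 * (c + k) + 8) := by
  have h1 : n.choose k ≤ n ^ k := Nat.choose_le_pow n k
  have hn1 : 1 ≤ n := by omega
  have hck : n ^ c ≤ n ^ (c + k) := Nat.pow_le_pow_right hn1 (by omega)
  have hkc : n ^ k ≤ n ^ (c + k) := Nat.pow_le_pow_right hn1 (by omega)
  have h0 : 1 ≤ n ^ (c + k) := Nat.one_le_pow _ _ hn1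
  have h11 : 2 * (s + (n.choose k + 1)) + 5 ≤ 11 * n ^ (c + k) := by omega
  have h16 : 16 ≤ n ^ 4 := by
    have := Nat.pow_le_pow_left hn 4
    simpa using this
  have hstep : 11 * n ^ (c + k) ≤ n ^ (c + k + 4) := by
    calc 11 * n ^ (c + k) ≤ 16 * n ^ (c + k) := by omega
      _ ≤ n ^ 4 * n ^ (c + k) := Nat.mul_le_mul_right _ h16
      _ = n ^ (c + k + 4) := by ring
  have hn_le : n ^ (c + k + 4) ≤ (5 * j) ^ (c + k + 4) := Nat.pow_le_pow_left hnj _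
  have h5j : 5 * j ≤ j * j := Nat.mul_le_mul_right j hj
  have hjj : (5 * j) ^ (c + k + 4) ≤ (j * j) ^ (c + k + 4) := Nat.pow_le_pow_left h5j _
  have hfin : (j * j) ^ (c + k + 4) = j ^ (2 * (c + k) + 8) := by
    rw [← pow_two, ← pow_mul, show 2 * (c + k + 4) = 2 * (c + k) + 8 by ring]
  omega

variable {n : ℕ}

/-- **The test circuit `G = [C ≠ CLIQUE_k]`** over `acBasis`: `acDepth ≤ d + 4`, `≤ 2(|C| + C(n,k) + 1) + 5` gates
(`(C ∧ ¬K) ∨ (¬C ∧ K)` with `K` the exhaustive clique DNF `exists_cliqueDNF_monotoneAC`; `ACReal` toolkit). [folklore] -/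
theorem exists_xorClique_circuit (k : ℕ) {d : ℕ} (C : Circuit (Edge n)) (hC : C.IsOver acBasis)
    (hd : C.acDepth ≤ d) :
    ∃ G : Circuit (Edge n), G.IsOver acBasis ∧ G.acDepth ≤ d + 4 ∧
      G.size ≤ 2 * (C.size + (n.choose k + 1)) + 5 ∧ ∀ x, G.eval x = (C.eval x != cliqueFn n k x) := by
  obtain ⟨K, hKB, hKd, hKs, hKe⟩ := exists_cliqueDNF_monotoneAC n k
  have hCr : ACReal C.eval (max d 2) C.size :=
    (ACReal.of_circuit C hC hd le_rfl).mono (le_max_left _ _) le_rfl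
  have hKr : ACReal (cliqueFn n k) (max d 2) (n.choose k + 1) :=
    ((ACReal.of_circuit K (hKB.mono monotoneACBasis_subset_acBasis)
      ((acDepth_le_depth K).trans hKd) hKs).congr hKe).mono (le_max_right _ _) le_rfl
  have h1 := acReal_and hCr hKr.neg
  have h2 := acReal_and hCr.neg hKr
  have h3 := acReal_or h1 h2
  have h4 : ACReal (fun x => (C.eval x != cliqueFn n k x)) (max d 2 + 1 + 1)
      (C.size + (n.choose k + 1 + 1) + 1 + (C.size + 1 + (n.choose k + 1) + 1) + 1) :=
    h3.congr fun x => by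
      cases hc : C.eval x <;> cases hq : cliqueFn n k x <;> simp
  obtain ⟨G, hGB, hGd, hGs, hGe⟩ := h4.toCircuit
  exact ⟨G, hGB, hGd.trans (by omega), hGs.trans (by omega), hGe⟩

/-- `|E(K_n)| = C(n,2)` (re-export of `card_edgeSet_top_fin`). [folklore] -/
theorem card_edge (n : ℕ) : Fintype.card (Edge n) = n.choose 2 := card_edgeSet_top_fin n

/-- On edge vectors the slice average of `G = [C ≠ K]` is the Disproof's `sliceErr / sliceCard`
(`wt = edgeCount` definitionally). [folklore] -/
theorem sliceAvg_edge_eq (j : ℕ) {C K G : (Edge n → Bool) → Bool} (hG : ∀ x, G x = (C x != K x)) :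
    sliceAvg G j = (sliceErr n j C K : ℝ) / (sliceCard n j : ℝ) := by
  have hnum : (univ.filter fun x : Edge n → Bool => wt x = j ∧ G x = true) =
      (univ.filter fun x : Edge n → Bool => edgeCount x = j ∧ C x ≠ K x) := by
    refine Finset.filter_congr fun x _ => ?_
    rw [hG x]
    exact and_congr Iff.rfl bne_iff_ne
  have hden : (univ.filter fun x : Edge n → Bool => wt x = j) =
      (univ.filter fun x : Edge n → Bool => edgeCount x = j) := rfl
  unfold sliceAvg sliceErr sliceCard
  rw [hnum, hden]

/-- On edge vectors the `μ_q`-average of `G = [C ≠ K]` is `gnpDisagreeProb n q C K`. [folklore] -/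
theorem prodAvg_edge_eq (q : ℝ) {C K G : (Edge n → Bool) → Bool} (hG : ∀ x, G x = (C x != K x)) :
    prodAvg q G = gnpDisagreeProb n q C K := by
  have hfil : (univ.filter fun x : Edge n → Bool => G x = true) =
      (univ.filter fun x : Edge n → Bool => C x ≠ K x) :=
    Finset.filter_congr fun x _ => by rw [hG x]; exact bne_iff_ne
  unfold prodAvg gnpDisagreeProb
  rw [hfil]
  refine Finset.sum_congr rfl fun x _ => ?_
  rw [prodWeight, gnpWeight, card_edge]
  rfl

/-- **The transfer (reduction) `SliceIndist → Hyp → Conc`** — formerly stub S5, now proved. Given `Hyp` and `(d,c)`: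
take `(k, δ_H)` from `Hyp d c`, answer with the same `k` and `δ := δ_H/2`; for large `n`, central `j` and `C` over
`acBasis` of `acDepth ≤ d` with slice error `≤ δ·#slice_j`: either `n^c < |C|` outright, or the test circuit
`G = [C ≠ CLIQUE_k]` (`exists_xorClique_circuit`) has `≤ j^{2(c+k)+8}` gates (`window_eventually`, `size_bound`),
`a_j(G) ≤ δ_H/2` (`sliceAvg_edge_eq`), so `SliceIndist (d+4) (2(c+k)+8) (δ_H/2)` gives
`gnpDisagreeProb n (j/C(n,2)) C CLIQUE_k = E_{j/C(n,2)} G ≤ δ_H` (`prodAvg_edge_eq`), and `Hyp` at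
`q = j/C(n,2) ∈ [0,1]` — window clause `|q·C(n,2) − m_k| = |j − m_k|` verbatim — yields `n^c < |C|`. [folklore] -/
theorem transfer (hI : SliceIndist) : CruxHyp → CruxConc := by
  intro hH d c
  obtain ⟨k, hk3, δH, hδH, hHyp⟩ := hH d c
  refine ⟨k, hk3, δH / 2, half_pos hδH, ?_⟩
  obtain ⟨j₀, hj₀⟩ := hI (d + 4) (2 * (c + k) + 8) (δH / 2) (half_pos hδH)
  filter_upwards [hHyp, window_eventually hk3 (max j₀ 5), eventually_ge_atTop 2] with n hn hw hn2 j hj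
    C hC hd herr
  obtain ⟨hjj₀, hnj, h2j⟩ := hw j hj
  have hj₀j : j₀ ≤ j := (le_max_left _ _).trans hjj₀
  have hj5 : 5 ≤ j := (le_max_right _ _).trans hjj₀
  by_cases hbig : n ^ c < C.size
  · exact hbig
  have hs : C.size ≤ n ^ c := not_lt.1 hbig
  -- the test circuit and its size
  obtain ⟨G, hGB, hGd, hGs, hGe⟩ := exists_xorClique_circuit k C hC hd
  have hGsz : G.size ≤ j ^ (2 * (c + k) + 8) := hGs.trans (size_bound hn2 hj5 hnj hs)
  -- indistinguishability of slice `j` and `G(n, j/C(n,2))` for `G`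
  have h2j' : 2 * j ≤ Fintype.card (Edge n) := by rw [card_edge]; exact h2j
  have key := hj₀ (Edge n) j hj₀j h2j' G hGB hGd hGsz
  rw [card_edge, sliceAvg_edge_eq j hGe, prodAvg_edge_eq _ hGe] at key
  -- slice error ≤ δ_H/2, hence G(n,q)-error ≤ δ_H
  have hsl : (sliceErr n j C.eval (cliqueFn n k) : ℝ) / (sliceCard n j : ℝ) ≤ δH / 2 :=
    div_le_of_le_mul₀ (Nat.cast_nonneg _) (half_pos hδH).le herr
  have hgnp : gnpDisagreeProb n ((j : ℝ) / ((n.choose 2 : ℕ) : ℝ)) C.eval (cliqueFn n k) ≤ δH := by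
    have := (abs_sub_le_iff.1 key).1
    linarith
  -- fire `Hyp` at `q = j / C(n,2)`
  have hNpos : (0 : ℝ) < ((n.choose 2 : ℕ) : ℝ) := by exact_mod_cast (show 0 < n.choose 2 by omega)
  have hq0 : 0 ≤ (j : ℝ) / ((n.choose 2 : ℕ) : ℝ) := div_nonneg (Nat.cast_nonneg _) hNpos.le
  have hq1 : (j : ℝ) / ((n.choose 2 : ℕ) : ℝ) ≤ 1 := by
    rw [div_le_one hNpos]; exact_mod_cast (show j ≤ n.choose 2 by omega)
  have hqw : |(j : ℝ) / ((n.choose 2 : ℕ) : ℝ) * ((n.choose 2 : ℕ) : ℝ) - (mk n k : ℝ)| ≤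
      (mk n k : ℝ) ^ ((3 : ℝ) / 4) := by
    rw [div_mul_cancel₀ _ hNpos.ne']; exact hj
  exact hn _ hq0 hq1 hqw C hC hd hgnp

end Transfer

/-! ### The kernel-checked composition -/

/-- **Composition.** The five stubs imply the crux BY NAME: S1–S3 and Boppana (`boppana_of` S4a S4b) give `SliceIndist` (`sliceIndist_of`), the
proved `transfer` turns it into `Hyp → Conc`, which is `SliceACZero` read back (`sliceACZero_iff`). No `sorry`. -/
theorem SliceACZero_of (hCoupling : Registered.stub_sliceCoupling)
    (hHazard : Registered.stub_binomialHazard) (hAndCoin : Registered.stub_andCoin)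
    (hFourier : Registered.stub_influenceFourier) (hTal : Registered.stub_talInfluence) :
    Summit.PneNP.PneNP.Theses.OneSlice.SliceACZero :=
  sliceACZero_iff.2 (transfer (sliceIndist_of hCoupling hHazard hAndCoin (boppana_of hFourier hTal)))

/-- The same composition fed with the registered stubs (the crux modulo the five `stub_*` sorries; an
`example`, so that `SliceACZero_of` stays the unique theorem concluding the crux). -/
example : Summit.PneNP.PneNP.Theses.OneSlice.SliceACZero :=
  SliceACZero_of stub_sliceCoupling stub_binomialHazard stub_andCoin stub_influenceFourier stub_talInfluence

end Summit.PneNP.PneNP.Cruxes.SliceACZero.RussoWindowLadder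

end
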